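import Mathlib
import Literature.AlgebraicGeometry.Tropical.TorusCycles
import Summits.HodgeConjecture.HodgeConjecture.Theorems.TropicalWeilObstructionTropicalWeilVanishingTransportPhase
import HarnessLib

/-!
# Crux `TropicalWeilVanishing` (stmt-HodgeConjecture-18478) — transporting a REALISATION FAMILY along an integral
# `ℤ[i]`-linear map: the transported cycle is an unobstructed seed on the congruent period

Route `TropicalWeilObstruction` of `HodgeConjecture` (Hodge NEGATION SINK `pub-hodge-tropical`; scoped exploration,
no summit claim; nothing here bears on the Hodge conjecture and nothing here decides K1).

`…TransportPhase.exists_transport` pushes ONE effective tropical `n`-cycle forward along `x ↦ F(sx)`. Here the whole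
realisation family of its combinatorial type (as produced by `genericSpread` at a Weil-generic period: real data
over EVERY symmetric `J`-commuting period) is transported along the congruence `P ↦ F P Fᵀ` (`s = (det F)²`,
`K = det F · adj(F)ᵀ`):

* `transport_linearData` — the edge and facet identities of `…TransportCycles.transport_realData` for arbitrary
  (not necessarily positively oriented) real data, i.e. for solutions of the LINEARISED realisation system;
* `exists_transport_seed` — the transported cycle `Z₀` on `ℝ²ⁿ/(FPFᵀ)·ℤ²ⁿ` (same number of cells, frames
  `F L_σ = L'_σ R_σ`, `W(Z₀) = sⁿ det_ℂ(F)² W(Z)`, `μ(Z₀) = sⁿ |det_ℂ F|² μ(Z)`) has its linearised realisation system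
  solvable in EVERY symmetric `J`-commuting direction `D` (transport the realisations over `P + F⁻¹DF⁻ᵀ` and over
  `P` and subtract) — exactly the hypothesis `hsec` of the tree's any-base seed transports
  (`exists_weilGeneric_weilFunctional_ne_zero_of_unobstructedSeed`, p351568;
  `exists_weilGeneric_calibrated_of_collinear_unobstructedSeed`, p358045).

Used by `…TropicalWeilVanishingBoundaryPhases` (K1_∂ has no preferred phase). Mathlib + the tree's transport
lemmas; no definition, no named fact, no sorry.

## References

* [MikhalkinZharkov2014Eigenwave] G. Mikhalkin, I. Zharkov, Tropical eigenwave and intermediate Jacobians,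
  LN UMI 15 (2014), Def. 4.2, Prop. 4.3, Def. 6.1.
* [Zharkov2020TropicalWeil] I. Zharkov, Tropical abelian varieties, Weil classes and the Hodge conjecture,
  arXiv:2002.02347 (2020), §2 (pp. 2–4).
-/

-- `Summit.HodgeConjecture.HodgeConjecture.…` is the mandated namespace (single-conjunct summit).
set_option linter.dupNamespace false

noncomputable section

open scoped BigOperators Matrix ComplexConjugate Topology
open Filter Matrix Literature.AlgebraicGeometry.Tropical

namespace Summit.HodgeConjecture.HodgeConjecture.Theorems.TropicalWeilVanishing.Phases

/-! ## §0 Display-only notation (verbatim bodies of the K3 / Boundary / TransportPhase files; nothing is defined) -/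

/-- The hermitian mass `μ(Z)` (display-only). -/
local notation3 (prettyPrint := false) "μ⟦" n ", " Z "⟧" =>
  (∑ σ, ((TropicalTorusCycle.cell Z σ).weight : ℝ) * (TropicalTorusCycle.cell Z σ).latticeVolume *
    ‖frameComplexDet n (TropicalTorusCycle.cell Z σ).frame‖ ^ 2)

/-- `det_ℂ(F)` (display-only; as in `…TransportPhase`). -/
local notation3 (prettyPrint := false) "detC⟦" n ", " F "⟧" =>
  (Matrix.det (Matrix.of fun k j : Fin n =>
    ((F ⟨(k : ℕ), Nat.lt_of_lt_of_le k.isLt (Nat.le_mul_of_pos_left n Nat.two_pos)⟩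
        ⟨(j : ℕ), Nat.lt_of_lt_of_le j.isLt (Nat.le_mul_of_pos_left n Nat.two_pos)⟩ : ℤ) : ℂ) +
      ((F ⟨(k : ℕ) + n, Nat.lt_of_lt_of_eq (Nat.add_lt_add_right k.isLt n) (two_mul n).symm⟩
        ⟨(j : ℕ), Nat.lt_of_lt_of_le j.isLt (Nat.le_mul_of_pos_left n Nat.two_pos)⟩ : ℤ) : ℂ) * Complex.I))

/-! ## §1 Transport of a realisation family: the transported cycle is a seed realisable in every direction -/

variable {n : ℕ}

/-- **Linearised real data transport** (the edge and facet identities of `…TransportCycles.transport_realData`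
without the positivity of the edge matrices, which plays no role in them): if `(v, T, r)` solve the edge equations
of the frames `L_σ` and the facet identifications of the type over `P`, and `F L_σ = L'_σ R_σ`, `F·(sP) = Q'·K`,
then `(F(sv), R_σ(sT_σ), F(sr))` solve them for the frames `L'_σ`, shifts `K k_{σ,i}`, over `Q'`.
[cite: MikhalkinZharkov2014Eigenwave, Def. 4.2 and Prop. 4.3] -/
theorem transport_linearData {g p Nc Nf : ℕ}
    (L : Fin Nc → Matrix (Fin g) (Fin p) ℤ) (cls : Fin Nc → Fin (p + 1) → Fin Nf)
    (prm : Fin Nc → Fin (p + 1) → Equiv.Perm (Fin p)) (sh : Fin Nc → Fin (p + 1) → Fin g → ℤ)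
    (P : Matrix (Fin g) (Fin g) ℝ)
    (v : Fin Nc → Fin (p + 1) → Fin g → ℝ) (T : Fin Nc → Matrix (Fin p) (Fin p) ℝ)
    (ref : Fin Nf → Fin p → Fin g → ℝ)
    (hv : ∀ (σ : Fin Nc) (j : Fin p) (a : Fin g),
      v σ j.succ a - v σ 0 a = ∑ m, (L σ a m : ℝ) * T σ m j)
    (hfe : ∀ (σ : Fin Nc) (i : Fin (p + 1)) (j : Fin p) (a : Fin g),
      v σ (i.succAbove (prm σ i j)) a = ref (cls σ i) j a + ∑ b, P a b * (sh σ i b : ℝ))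
    (F : Matrix (Fin g) (Fin g) ℤ) (L' : Fin Nc → Matrix (Fin g) (Fin p) ℤ)
    (R : Fin Nc → Matrix (Fin p) (Fin p) ℤ) (hfac : ∀ σ, F * L σ = L' σ * R σ)
    (s : ℝ) (K : Matrix (Fin g) (Fin g) ℤ)
    (Q' : Matrix (Fin g) (Fin g) ℝ) (hK : F.map ((↑) : ℤ → ℝ) * (s • P) = Q' * K.map ((↑) : ℤ → ℝ)) :
    (∀ (σ : Fin Nc) (j : Fin p) (a : Fin g),
        (F.map ((↑) : ℤ → ℝ) *ᵥ (s • v σ j.succ)) a - (F.map ((↑) : ℤ → ℝ) *ᵥ (s • v σ 0)) a =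
          ∑ m, (L' σ a m : ℝ) * ((R σ).map ((↑) : ℤ → ℝ) * (s • T σ)) m j) ∧
    (∀ (σ : Fin Nc) (i : Fin (p + 1)) (j : Fin p) (a : Fin g),
        (F.map ((↑) : ℤ → ℝ) *ᵥ (s • v σ (i.succAbove (prm σ i j)))) a =
          (F.map ((↑) : ℤ → ℝ) *ᵥ (s • ref (cls σ i) j)) a +
            ∑ b, Q' a b * ((K *ᵥ sh σ i) b : ℝ)) := by
  refine ⟨?_, ?_⟩
  · intro σ j a
    have hfac' : ∀ m' : Fin p, ∑ c, (F a c : ℝ) * (L σ c m' : ℝ) = ∑ m, (L' σ a m : ℝ) * (R σ m m' : ℝ) := by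
      intro m'
      have h := congrFun (congrFun (hfac σ) a) m'
      simp only [Matrix.mul_apply] at h
      exact_mod_cast h
    simp only [Matrix.mulVec, dotProduct, Matrix.map_apply, Pi.smul_apply, smul_eq_mul,
      Matrix.mul_apply, Matrix.smul_apply]
    rw [← Finset.sum_sub_distrib]
    have step1 : ∑ c, ((F a c : ℝ) * (s * v σ j.succ c) - (F a c : ℝ) * (s * v σ 0 c)) =
        ∑ m', s * ((∑ c, (F a c : ℝ) * (L σ c m' : ℝ)) * T σ m' j) := by
      calc ∑ c, ((F a c : ℝ) * (s * v σ j.succ c) - (F a c : ℝ) * (s * v σ 0 c))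
          = ∑ c, (F a c : ℝ) * s * (v σ j.succ c - v σ 0 c) :=
            Finset.sum_congr rfl fun c _ => by ring
        _ = ∑ c, (F a c : ℝ) * s * ∑ m', (L σ c m' : ℝ) * T σ m' j :=
            Finset.sum_congr rfl fun c _ => by rw [hv σ j c]
        _ = ∑ c, ∑ m', s * ((F a c : ℝ) * (L σ c m' : ℝ) * T σ m' j) := by
            refine Finset.sum_congr rfl fun c _ => ?_
            rw [Finset.mul_sum]
            exact Finset.sum_congr rfl fun m' _ => by ring
        _ = ∑ m', ∑ c, s * ((F a c : ℝ) * (L σ c m' : ℝ) * T σ m' j) := Finset.sum_comm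
        _ = ∑ m', s * ((∑ c, (F a c : ℝ) * (L σ c m' : ℝ)) * T σ m' j) := by
            refine Finset.sum_congr rfl fun m' _ => ?_
            rw [Finset.sum_mul, Finset.mul_sum]
    rw [step1]
    simp_rw [hfac']
    calc ∑ m', s * ((∑ m, (L' σ a m : ℝ) * (R σ m m' : ℝ)) * T σ m' j)
        = ∑ m', ∑ m, (L' σ a m : ℝ) * ((R σ m m' : ℝ) * (s * T σ m' j)) := by
          refine Finset.sum_congr rfl fun m' _ => ?_
          rw [Finset.sum_mul, Finset.mul_sum]
          exact Finset.sum_congr rfl fun m _ => by ring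
      _ = ∑ m, ∑ m', (L' σ a m : ℝ) * ((R σ m m' : ℝ) * (s * T σ m' j)) := Finset.sum_comm
      _ = ∑ m, (L' σ a m : ℝ) * ∑ m', (R σ m m' : ℝ) * (s * T σ m' j) := by
          refine Finset.sum_congr rfl fun m _ => ?_
          rw [Finset.mul_sum]
  · intro σ i j a
    have hK' : ∀ b : Fin g, ∑ c, (F a c : ℝ) * (s * P c b) = ∑ b', Q' a b' * (K b' b : ℝ) := by
      intro b
      have h := congrFun (congrFun hK a) b
      simpa only [Matrix.mul_apply, Matrix.map_apply, Matrix.smul_apply, smul_eq_mul] using h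
    simp only [Matrix.mulVec, dotProduct, Matrix.map_apply, Pi.smul_apply, smul_eq_mul]
    push_cast
    calc ∑ c, (F a c : ℝ) * (s * v σ (i.succAbove (prm σ i j)) c)
        = ∑ c, (F a c : ℝ) * (s * (ref (cls σ i) j c + ∑ b, P c b * (sh σ i b : ℝ))) :=
          Finset.sum_congr rfl fun c _ => by rw [hfe σ i j c]
      _ = ∑ c, ((F a c : ℝ) * (s * ref (cls σ i) j c) +
            ∑ b, (F a c : ℝ) * (s * P c b) * (sh σ i b : ℝ)) := by
          refine Finset.sum_congr rfl fun c _ => ?_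
          rw [mul_add, mul_add, Finset.mul_sum, Finset.mul_sum]
          congr 1
          exact Finset.sum_congr rfl fun b _ => by ring
      _ = ∑ c, (F a c : ℝ) * (s * ref (cls σ i) j c) +
            ∑ b, (∑ c, (F a c : ℝ) * (s * P c b)) * (sh σ i b : ℝ) := by
          rw [Finset.sum_add_distrib]
          congr 1
          rw [Finset.sum_comm]
          exact Finset.sum_congr rfl fun b _ => by rw [Finset.sum_mul]
      _ = ∑ c, (F a c : ℝ) * (s * ref (cls σ i) j c) +
            ∑ b', Q' a b' * ∑ b, (K b' b : ℝ) * (sh σ i b : ℝ) := by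
          congr 1
          simp_rw [hK', Finset.sum_mul, Finset.mul_sum]
          rw [Finset.sum_comm]
          exact Finset.sum_congr rfl fun b' _ => Finset.sum_congr rfl fun b _ => by ring

/-- **Transport of a realisation family along a congruence: an unobstructed seed on the congruent period.**
Let `Z` be an effective tropical `n`-cycle on `ℝ²ⁿ/P·ℤ²ⁿ` whose combinatorial type realises over EVERY symmetric
`J`-commuting period (`hreal`; e.g. the `genericSpread` of a cycle at a Weil-generic period), and `F` integral with
`FJ = JF`, `det F ≠ 0`. Then on the congruent period `Q₀ = F P Fᵀ` (transport with `s = (det F)²`,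
`K = det F · adj(F)ᵀ`) there is an effective tropical `n`-cycle `Z₀` with the same number of cells, frames
`F L_σ = L'_σ R_σ` (`det R_σ > 0`), `W(Z₀) = sⁿ det_ℂ(F)² W(Z)`, `μ(Z₀) = sⁿ |det_ℂ F|² μ(Z)`, whose LINEARISED
REALISATION SYSTEM IS SOLVABLE IN EVERY symmetric `J`-commuting direction `D` (transport the realisations over
`P + F⁻¹DF⁻ᵀ` and over `P`, subtract). [cite: MikhalkinZharkov2014Eigenwave, Def. 4.2 and Prop. 4.3]
[cite: Zharkov2020TropicalWeil, §2 (pp. 2–4)] -/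
theorem exists_transport_seed {P : Matrix (Fin (2 * n)) (Fin (2 * n)) ℝ} (hPS : P.IsSymm)
    (hPJ : P * weilJ n = weilJ n * P) (Z : TropicalTorusCycle (2 * n) n P)
    (hreal : ∀ P' : Matrix (Fin (2 * n)) (Fin (2 * n)) ℝ, P'.IsSymm → P' * weilJ n = weilJ n * P' →
      ∃ (v : Fin Z.numCells → Fin (n + 1) → Fin (2 * n) → ℝ) (T : Fin Z.numCells → Matrix (Fin n) (Fin n) ℝ)
        (r : Fin Z.numFacetClasses → Fin n → Fin (2 * n) → ℝ),
        (∀ (σ : Fin Z.numCells) (j : Fin n) (a : Fin (2 * n)),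
            v σ j.succ a - v σ 0 a = ∑ m, ((Z.cell σ).frame a m : ℝ) * T σ m j) ∧
        (∀ (σ : Fin Z.numCells) (i : Fin (n + 1)) (j : Fin n) (a : Fin (2 * n)),
            v σ (i.succAbove (Z.facetPerm σ i j)) a =
              r (Z.facetClass σ i) j a + ∑ b, P' a b * (Z.facetShift σ i b : ℝ)))
    (F : Matrix (Fin (2 * n)) (Fin (2 * n)) ℤ) (hFdet : F.det ≠ 0)
    (hFJ : F.map ((↑) : ℤ → ℝ) * weilJ n = weilJ n * F.map ((↑) : ℤ → ℝ)) :
    ∃ Z₀ : TropicalTorusCycle (2 * n) n (F.map ((↑) : ℤ → ℝ) * P * (F.map ((↑) : ℤ → ℝ))ᵀ),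
      ∃ hc : Z₀.numCells = Z.numCells,
        (∀ σ : Fin Z₀.numCells, ∃ R : Matrix (Fin n) (Fin n) ℤ, 0 < R.det ∧
          F * (Z.cell (Fin.cast hc σ)).frame = (Z₀.cell σ).frame * R) ∧
        weilFunctional Z₀ = ((((F.det : ℝ) ^ 2) ^ n : ℝ) : ℂ) * detC⟦n, F⟧ ^ 2 * weilFunctional Z ∧
        μ⟦n, Z₀⟧ = ((F.det : ℝ) ^ 2) ^ n * ‖detC⟦n, F⟧‖ ^ 2 * μ⟦n, Z⟧ ∧
        ∀ D : Matrix (Fin (2 * n)) (Fin (2 * n)) ℝ, D.IsSymm → D * weilJ n = weilJ n * D →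
          ∃ (v : Fin Z₀.numCells → Fin (n + 1) → Fin (2 * n) → ℝ)
            (T : Fin Z₀.numCells → Matrix (Fin n) (Fin n) ℝ)
            (r : Fin Z₀.numFacetClasses → Fin n → Fin (2 * n) → ℝ),
            (∀ (σ : Fin Z₀.numCells) (j : Fin n) (a : Fin (2 * n)),
                v σ j.succ a - v σ 0 a = ∑ m, ((Z₀.cell σ).frame a m : ℝ) * T σ m j) ∧
            (∀ (σ : Fin Z₀.numCells) (i : Fin (n + 1)) (j : Fin n) (a : Fin (2 * n)),
                v σ (i.succAbove (Z₀.facetPerm σ i j)) a =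
                  r (Z₀.facetClass σ i) j a + ∑ b, D a b * (Z₀.facetShift σ i b : ℝ)) := by
  classical
  obtain ⟨hF1, hF2⟩ := blocks_of_commute_weilJ F hFJ
  set Fr : Matrix (Fin (2 * n)) (Fin (2 * n)) ℝ := F.map ((↑) : ℤ → ℝ) with hFr
  have hFrdet : Fr.det ≠ 0 := by rw [hFr, ← Int.cast_det]; exact_mod_cast hFdet
  have hFrunit : IsUnit Fr.det := isUnit_iff_ne_zero.2 hFrdet
  have hFrTunit : IsUnit Frᵀ.det := by rw [Matrix.det_transpose]; exact hFrunit
  set Nr : ℝ := (F.det : ℝ) with hNr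
  have hNr0 : Nr ≠ 0 := by rw [hNr]; exact_mod_cast hFdet
  have hinv1 : Fr * Fr⁻¹ = 1 := Matrix.mul_nonsing_inv Fr hFrunit
  have hinv2 : Fr⁻¹ * Fr = 1 := Matrix.nonsing_inv_mul Fr hFrunit
  have hadj : Nr • Fr⁻¹ = Fr.adjugate := by
    rw [Matrix.inv_def, Ring.inverse_eq_inv', smul_smul, hNr, hFr, ← Int.cast_det,
      mul_inv_cancel₀ (by exact_mod_cast hFdet), one_smul]
  have hadjmap : Fr.adjugate = F.adjugate.map ((↑) : ℤ → ℝ) := by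
    have h := RingHom.map_adjugate (Int.castRingHom ℝ) F
    rw [RingHom.mapMatrix_apply, RingHom.mapMatrix_apply] at h
    rw [hFr]
    exact h.symm
  -- `K = N adj(F)ᵀ`, `s = N²`
  set K : Matrix (Fin (2 * n)) (Fin (2 * n)) ℤ := Matrix.of fun a b => F.det * F.adjugate b a with hK
  have hKr : K.map ((↑) : ℤ → ℝ) = Nr • (Nr • Fr⁻¹)ᵀ := by
    rw [hadj, hadjmap]
    ext a b
    simp [hK, Matrix.map_apply, Matrix.transpose_apply, hNr]
  set s : ℝ := Nr ^ 2 with hs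
  have hspos : 0 < s := by rw [hs]; positivity
  -- `F (s P') = (F P' Fᵀ) K` for every `P'`
  have hKeq : ∀ P' : Matrix (Fin (2 * n)) (Fin (2 * n)) ℝ,
      Fr * (s • P') = (Fr * P' * Frᵀ) * K.map ((↑) : ℤ → ℝ) := by
    intro P'
    rw [hKr, Matrix.transpose_smul, smul_smul, Matrix.mul_smul, Matrix.mul_smul, hs, sq,
      Matrix.transpose_nonsing_inv, Matrix.mul_assoc (Fr * P'), Matrix.mul_nonsing_inv _ hFrTunit,
      Matrix.mul_one]
  -- discrete and real data of the transported cycle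
  obtain ⟨w', L', R, hw'pos, hsat', hfac, hRdet, hw'eq, hbal'⟩ :=
    transport_typeData (fun σ => (Z.cell σ).weight) (fun σ => (Z.cell σ).weight_pos)
      (fun σ => (Z.cell σ).frame) (fun σ => (Z.cell σ).frame_saturated) Z.facetClass Z.facetPerm
      Z.balanced F hFdet
  obtain ⟨hv, hT, hfe⟩ := transport_realData (fun σ => (Z.cell σ).frame) Z.facetClass Z.facetPerm Z.facetShift
    P (fun σ => (Z.cell σ).vertex) (fun σ => (Z.cell σ).edgeCoeff) Z.refFacet
    (fun σ j a => (Z.cell σ).vertex_succ_sub j a) (fun σ => (Z.cell σ).edgeCoeff_det_pos) Z.facet_eq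
    F L' R hfac hRdet s hspos K (Fr * P * Frᵀ) (hKeq P)
  let Z₀ : TropicalTorusCycle (2 * n) n (Fr * P * Frᵀ) :=
    { numCells := Z.numCells
      cell := fun σ =>
        { weight := w' σ
          weight_pos := hw'pos σ
          vertex := fun j => Fr *ᵥ (s • (Z.cell σ).vertex j)
          frame := L' σ
          edgeCoeff := (R σ).map ((↑) : ℤ → ℝ) * (s • (Z.cell σ).edgeCoeff)
          vertex_succ_sub := hv σ
          edgeCoeff_det_pos := hT σ
          frame_saturated := hsat' σ }
      numFacetClasses := Z.numFacetClasses
      refFacet := fun f j => Fr *ᵥ (s • Z.refFacet f j)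
      facetClass := Z.facetClass
      facetPerm := Z.facetPerm
      facetShift := fun σ i => K *ᵥ Z.facetShift σ i
      facet_eq := hfe
      balanced := hbal' }
  refine ⟨Z₀, rfl, fun σ => ⟨R σ, hRdet σ, hfac σ⟩, ?_, ?_, ?_⟩
  · -- Weil functional
    show (∑ σ : Fin Z.numCells, ((w' σ : ℕ) : ℂ) *
        ((((R σ).map ((↑) : ℤ → ℝ) * (s • (Z.cell σ).edgeCoeff)).det / (n.factorial : ℝ) : ℝ) : ℂ) *
        frameComplexDet n (L' σ) ^ 2) = _
    rw [transport_weilFunctional (fun σ => (Z.cell σ).weight) w' (fun σ => (Z.cell σ).frame) L' R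
      (fun σ => (Z.cell σ).edgeCoeff) F hF1 hF2 hfac hw'eq s]
    rfl
  · -- mass
    show (∑ σ : Fin Z.numCells, ((w' σ : ℕ) : ℝ) *
        (((R σ).map ((↑) : ℤ → ℝ) * (s • (Z.cell σ).edgeCoeff)).det / (n.factorial : ℝ)) *
        ‖frameComplexDet n (L' σ)‖ ^ 2) = _
    rw [Finset.mul_sum]
    refine Finset.sum_congr rfl fun σ _ => ?_
    have key : frameComplexDet n (L' σ) * ((R σ).det : ℂ) = detC⟦n, F⟧ * frameComplexDet n (Z.cell σ).frame :=
      frameComplexDet_transport F hFJ _ _ _ (hfac σ)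
    have hnormkey : ‖frameComplexDet n (L' σ)‖ * ((R σ).det : ℝ) =
        ‖detC⟦n, F⟧‖ * ‖frameComplexDet n (Z.cell σ).frame‖ := by
      have := congrArg (fun z : ℂ => ‖z‖) key
      simp only [norm_mul, Complex.norm_intCast] at this
      rwa [abs_of_pos (show (0 : ℝ) < (R σ).det by exact_mod_cast hRdet σ)] at this
    have hw'σ : ((w' σ : ℕ) : ℝ) = ((Z.cell σ).weight : ℝ) * ((R σ).det : ℝ) := by
      have := hw'eq σ
      exact_mod_cast this
    have hdet : ((R σ).map ((↑) : ℤ → ℝ) * (s • (Z.cell σ).edgeCoeff)).det =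
        ((R σ).det : ℝ) * (s ^ n * ((Z.cell σ).edgeCoeff).det) := by
      rw [Matrix.det_mul, Matrix.det_smul, Fintype.card_fin, ← Int.cast_det]
    rw [hdet, hw'σ]
    unfold TropicalCell.latticeVolume
    have e : ((Z.cell σ).weight : ℝ) * ((R σ).det : ℝ) *
        (((R σ).det : ℝ) * (s ^ n * ((Z.cell σ).edgeCoeff).det) / (n.factorial : ℝ)) *
        ‖frameComplexDet n (L' σ)‖ ^ 2 =
        s ^ n * (‖frameComplexDet n (L' σ)‖ * ((R σ).det : ℝ)) ^ 2 *
          (((Z.cell σ).weight : ℝ) * (((Z.cell σ).edgeCoeff).det / (n.factorial : ℝ))) := by ring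
    rw [e, hnormkey]
    ring
  · -- sections in every direction `D`
    intro D hDS hDJ
    have hFrinvJ : Fr⁻¹ * weilJ n = weilJ n * Fr⁻¹ := by
      have h1 : Fr⁻¹ * (Fr * weilJ n) * Fr⁻¹ = Fr⁻¹ * (weilJ n * Fr) * Fr⁻¹ := by rw [hFJ]
      rw [← Matrix.mul_assoc, hinv2, Matrix.one_mul, Matrix.mul_assoc, Matrix.mul_assoc, hinv1,
        Matrix.mul_one] at h1
      exact h1.symm
    have hFrinvTJ : Fr⁻¹ᵀ * weilJ n = weilJ n * Fr⁻¹ᵀ := by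
      have h := congrArg Matrix.transpose hFrinvJ
      rw [Matrix.transpose_mul, Matrix.transpose_mul, TropicalWeilSupply.Negative.weilJ_transpose,
        Matrix.neg_mul, Matrix.mul_neg, neg_inj] at h
      exact h.symm
    set P₁ : Matrix (Fin (2 * n)) (Fin (2 * n)) ℝ := P + Fr⁻¹ * D * Fr⁻¹ᵀ with hP₁
    have hP₁S : P₁.IsSymm := by
      rw [hP₁]
      refine hPS.add ?_
      show (Fr⁻¹ * D * Fr⁻¹ᵀ)ᵀ = Fr⁻¹ * D * Fr⁻¹ᵀ
      rw [Matrix.transpose_mul, Matrix.transpose_mul, Matrix.transpose_transpose, hDS.eq, Matrix.mul_assoc]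
    have hP₁J : P₁ * weilJ n = weilJ n * P₁ := by
      have h3 : Fr⁻¹ * D * Fr⁻¹ᵀ * weilJ n = weilJ n * (Fr⁻¹ * D * Fr⁻¹ᵀ) := by
        rw [Matrix.mul_assoc, hFrinvTJ, ← Matrix.mul_assoc, Matrix.mul_assoc Fr⁻¹, hDJ, ← Matrix.mul_assoc,
          hFrinvJ, Matrix.mul_assoc, Matrix.mul_assoc, Matrix.mul_assoc]
      rw [hP₁, Matrix.add_mul, Matrix.mul_add, hPJ, h3]
    have htarget : Fr * P₁ * Frᵀ = Fr * P * Frᵀ + D := by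
      rw [hP₁, Matrix.mul_add, Matrix.add_mul]
      congr 1
      rw [show Fr * (Fr⁻¹ * D * Fr⁻¹ᵀ) * Frᵀ = (Fr * Fr⁻¹) * D * (Fr⁻¹ᵀ * Frᵀ) by
        simp only [Matrix.mul_assoc], hinv1, Matrix.transpose_nonsing_inv, Matrix.nonsing_inv_mul _ hFrTunit,
        Matrix.one_mul, Matrix.mul_one]
    obtain ⟨v₁, T₁, r₁, hv₁, hf₁⟩ := hreal P₁ hP₁S hP₁J
    obtain ⟨v₀, T₀, r₀, hv₀, hf₀⟩ := hreal P hPS hPJ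
    have hK₁ : Fr * (s • P₁) = (Fr * P * Frᵀ + D) * K.map ((↑) : ℤ → ℝ) := by rw [← htarget]; exact hKeq P₁
    obtain ⟨hE₁, hF₁⟩ := transport_linearData (fun σ => (Z.cell σ).frame) Z.facetClass Z.facetPerm Z.facetShift
      P₁ v₁ T₁ r₁ hv₁ hf₁ F L' R hfac s K (Fr * P * Frᵀ + D) hK₁
    obtain ⟨hE₀, hF₀⟩ := transport_linearData (fun σ => (Z.cell σ).frame) Z.facetClass Z.facetPerm Z.facetShift
      P v₀ T₀ r₀ hv₀ hf₀ F L' R hfac s K (Fr * P * Frᵀ) (hKeq P)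
    refine ⟨fun σ j a => (Fr *ᵥ (s • v₁ σ j)) a - (Fr *ᵥ (s • v₀ σ j)) a,
      fun σ => (R σ).map ((↑) : ℤ → ℝ) * (s • T₁ σ) - (R σ).map ((↑) : ℤ → ℝ) * (s • T₀ σ),
      fun f j a => (Fr *ᵥ (s • r₁ f j)) a - (Fr *ᵥ (s • r₀ f j)) a, ?_, ?_⟩
    · intro σ j a
      show (Fr *ᵥ (s • v₁ σ j.succ)) a - (Fr *ᵥ (s • v₀ σ j.succ)) a -
          ((Fr *ᵥ (s • v₁ σ 0)) a - (Fr *ᵥ (s • v₀ σ 0)) a) =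
        ∑ m, (L' σ a m : ℝ) * (((R σ).map ((↑) : ℤ → ℝ) * (s • T₁ σ) - (R σ).map ((↑) : ℤ → ℝ) * (s • T₀ σ)) m j)
      have e1 := hE₁ σ j a
      have e0 := hE₀ σ j a
      simp only [Matrix.sub_apply, mul_sub, Finset.sum_sub_distrib]
      rw [← e1, ← e0]
      ring
    · intro σ i j a
      show (Fr *ᵥ (s • v₁ σ (i.succAbove (Z.facetPerm σ i j)))) a -
          (Fr *ᵥ (s • v₀ σ (i.succAbove (Z.facetPerm σ i j)))) a =
        ((Fr *ᵥ (s • r₁ (Z.facetClass σ i) j)) a - (Fr *ᵥ (s • r₀ (Z.facetClass σ i) j)) a) +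
          ∑ b, D a b * (((K *ᵥ Z.facetShift σ i) b : ℤ) : ℝ)
      rw [hF₁ σ i j a, hF₀ σ i j a]
      simp only [Matrix.add_apply, add_mul, Finset.sum_add_distrib]
      ring

end Summit.HodgeConjecture.HodgeConjecture.Theorems.TropicalWeilVanishing.Phases

end
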